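import Summits.QuantumFields.YangMills.Theorems.BalabanUVNodesN08HaarCompatibilityGuardGeodesics
import Mathlib.Analysis.SpecialFunctions.Trigonometric.Bounds

/-!
# BalabanUVNodes ∕ N08 — GLOBAL INJECTIVITY of the printed exp-mean-log fibre ∕ core map on its guard set (NO SHEET COUNT), under an
# explicit smallness that holds at the [B10] slot `N = 2`, `δ₂ = 1∕3`, `Σcᵢ = 8∕9`

WIDTH SEAT `pub-ymgap-dag-n08-w3` g5, `W-SEAT-START-LIST.md` §0 (iii); item-3 lineage part 26B = the successor piece «injectivity on the ONE window» named in
part 25 (p621260 `…GuardOneWindow`, WHAT IS LEFT) and in `N08-EML-JACOBIAN.md` §2∕§6 (numerics: the guarded branch is globally `(1 − Σcᵢ)`-expanding —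
a CONJECTURE; «if proved, the density engine needs NO sheet count»), 2026-08-28.  DAG node N08 = [Balaban1985UV3] Thm 1 p. 257 + Thm 2 p. 272;
[Balaban1987RG1] (0.4) p. 253 (the typed averaging and its guard); key item K1⁷ `StabilityBAtRecordR13SepCoPH` (stmt-QuantumFields-20542, `aside` since
route rev 26∕27), `--supports … --as helper`.  COUNT-NEUTRAL.

WHAT THIS FILE PROVES (theorems only, 0 def; [folklore] calculus on the unit quaternions `S³ = SU(2)`; nothing of Bałaban's asserted).  Everything is stated
in pub-balaban's QUATERNION MODEL (`T4QuatExpLog`: `qlog`, `N`, `par`∕`perp`; `T4EMLFibreAC`: the exponent `Yf a c u = Σᵢ cᵢ•qlog(aᵢū)` and the fibre map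
`kf a c u = exp(Yf a c u)·u` — the one-variable law of the printed exp-mean-log average), consumed BY IMPORT.
 §0 (companion file, part 26A `…GuardGeodesics`, imported): quaternion trigonometry — chord ↔ angle (`norm_exp_sub_one_eq`, `norm_qlog_lt_of_chord`),
    **`‖N_w x‖ ≤ (θ∕sin θ)‖x‖`** (`norm_N_le`), **`exp` is 1-Lipschitz on `Im ℍ`** (`norm_exp_sub_exp_le`), **geodesic convexity of chordal balls**
    (`norm_sub_mul_exp_smul_lt`).
 §1 `YD_apply_mul` (`Y′(w)(w y) = −Σcᵢ N_{qlog(aᵢw̄)}(w y w̄)`, the computation inside pub-balaban's `kD_tangent_injective`, isolated) · ★★ `norm_Yf_sub_Yf_le`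
    (**`‖Y(u eˣ) − Y(u)‖ ≤ (Σcᵢ)(θ∕sin θ)‖x‖`** along a guarded geodesic: chain rule + §0 + the mean-value inequality on `[0,1]`) · `Yf_re_eq_zero` ·
    ★★★ `injOn_kf`: for unit `aᵢ`, `cᵢ ≥ 0`, `0 < θ ≤ 3∕8`, `δ ≤ sin θ` and **`(Σcᵢ)·θ² < sin²θ`**, `kf a c` is INJECTIVE on `{u : ‖u‖ = 1, ∀ i ‖aᵢū − 1‖ < δ}`
    (`k u = k u′ = z` ⇒ `e^{Y u} = zū`, `e^{Y u′} = zū′` ⇒ `‖u − u′‖ = ‖e^{Yu} − e^{Yu′}‖ ≤ ‖Yu − Yu′‖ ≤ (Σcᵢ)(θ∕sin θ)d`, while `‖u − u′‖ = 2 sin(d∕2) ≥ (sin θ∕θ)d`,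
    `d = ‖qlog(ūu′)‖ < 2θ`) · `injOn_kf_slot` (`δ = 1∕3`, `Σcᵢ ≤ 8∕9`, via `θ = 7∕20` and Mathlib's `Real.sin_gt_sub_cube`).
 §2 SU(2) matrix corollaries in the letters of `T4EMLFibreAC.haar_restrict_map_absolutelyContinuous_expMeanLog`: `coe_mul_star_coe_eq_quatMatrix` · `kf_su2Quat_eq`
    (`kf (su2Quat∘h) c (su2Quat W) = su2Quat (K W)` under the normal form `↑(K W) = exp(Σ(cᵢ:ℂ)•mlog(hᵢW*))·W`) · ★★ `injOn_expMeanLog` (`InjOn K S` under the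
    guard `‖hᵢW* − 1‖ < δ` on `S` and the smallness) · ★★ `injOn_expMeanLog_deltaSU` (the typed guard `deltaSU (Fin 2) ≤ 1∕3` and `Σcᵢ ≤ 8∕9`: at the record's
    `N = 2`, `L = 3`, `d = 3` the printed weights `cᵢ = 1∕#Idx` over non-central indices have `Σcᵢ = 1 − L^{1−d} = 8∕9`).
CONSEQUENCE (located, for part 25's `hinj`): the chart conjugate `ψc = χ₁⁻¹∘Φ_V∘χ₀` is injective on the window `W` as soon as `Φ_V` is injective on `χ₀(W) ⊆`
guard set (χ₀ = `w₀·expPauli` is injective on `ball(0,π)`) — so #windows = 1 with NO sheet count on this range; the dictionary `Φ_V = Kmat` on the guard is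
n08-w6's `…CoreKmatDictionary` (INTENT-5), not restated here.
HONEST LIMIT: the smallness `(Σcᵢ)θ² < sin²θ` fails for `L^{d−1} ≳ 27` at `δ = 1∕3`; the conjectured sharp `(1 − Σcᵢ)`-expansion for every `Σcᵢ < 1` is NOT
claimed.  HONEST FRAMING: (H_K) ∕ (H_K-core) NOT discharged by this file (it supplies part 25's `hinj` only); E6′ NOT decided; `hmass` NOT supplied;
count-neutral; N08 NOT discharged; counts unmoved (typed 28∕28 · discharged 5∕27); one finite 𝕋⁴ programme at fixed ε — R4 closes the CONDITIONAL rung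
`BalabanLadder.UV` only; the Yang–Mills mass gap (Clay) is NOT proved; nothing continuum ∕ OS.  0 `sorry`, standard axioms.
-/

noncomputable section

open NormedSpace Set Metric Function Filter
open scoped RealInnerProductSpace Topology Quaternion

namespace Summit.QuantumFields.YangMills.BalabanUVNodes.N08HaarCompatibilityGuardCoreInjective

open Literature.MathematicalPhysics.QuantumFieldTheory.Balaban1983to89
open Literature.MathematicalPhysics.QuantumFieldTheory.Balaban1983to89.T4QuatExpLog
open Literature.MathematicalPhysics.QuantumFieldTheory.Balaban1983to89.T4EMLFibreAC

open Summit.QuantumFields.YangMills.BalabanUVNodes.N08HaarCompatibilityGuardGeodesics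

/-! ## §1 The fibre map is injective on its guard set -/

section Fibre

variable {ι : Type*} [Fintype ι]

/-- THE LEFT-TRIVIALISED DERIVATIVE OF THE EXPONENT along a tangent vector `w·y` (`w` unit, `y` imaginary, guard `‖aᵢw̄ − 1‖ < 1∕2`):
`Y′(w)(w y) = −Σᵢ cᵢ N_{qlog(aᵢw̄)}(w y w̄)` (the computation inside pub-balaban's `kD_tangent_injective`, isolated). [folklore] -/
theorem YD_apply_mul {a : ι → ℍ} (c : ι → ℝ) {w y : ℍ} (hw : ‖w‖ = 1) (ha : ∀ i, ‖a i‖ = 1)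
    (hg : ∀ i, ‖a i * star w - 1‖ < 1 / 2) (hy : y.re = 0) :
    YD a c w (w * y) = -∑ i, c i • N (qlog (a i * star w)) (w * y * star w) := by
  have hsw : star w * w = 1 := by rw [Quaternion.star_mul_self, Quaternion.normSq_eq_norm_mul_self, hw]; simp
  have hW1 : ∀ i, ‖a i * star w‖ = 1 := fun i => by simp [norm_mul, ha i, hw]
  have hXre : (w * y * star w).re = 0 := re_mul_mul_star w hy
  rw [YD_apply, ← Finset.sum_neg_distrib]
  refine Finset.sum_congr rfl fun i _ => ?_
  have h1 : a i * star (w * y) = -(a i * star w * (w * y * star w)) := by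
    have : a i * star w * (w * y * star w) = a i * y * star w := by
      rw [show a i * star w * (w * y * star w) = a i * (star w * w) * y * star w by simp only [mul_assoc], hsw, mul_one]
    rw [this, star_mul, Quaternion.star_eq_neg.2 hy]
    simp [mul_assoc]
  rw [h1, map_neg, smul_neg, fderiv_qlog_apply_mul (hW1 i) (hg i) hXre]

/-- THE EXPONENT IS LIPSCHITZ ALONG GUARDED GEODESICS: for unit `aᵢ`, `cᵢ ≥ 0`, an angle `0 < θ ≤ 3∕8` and a chord `δ ≤ sin θ`, a unit `u` and an
imaginary `x` with `‖x‖ < π` such that the geodesic `u e^{tx}`, `t ∈ [0,1]`, stays in the guard `‖aᵢ − u e^{tx}‖ < δ`: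
`‖Y(u eˣ) − Y(u)‖ ≤ (Σᵢcᵢ)·(θ∕sin θ)·‖x‖` (chain rule `(Y∘γ)′(t) = Y′(γ_t)(γ_t x) = −Σcᵢ N_{Zᵢ(t)}(γ_t x γ̄_t)`, angles `‖Zᵢ(t)‖ < θ` through the chord,
`‖N_Z X‖ ≤ (θ∕sin θ)‖X‖`, mean-value inequality on `[0,1]`). [folklore] -/
theorem norm_Yf_sub_Yf_le {a : ι → ℍ} (c : ι → ℝ) (ha : ∀ i, ‖a i‖ = 1) (hc : ∀ i, 0 ≤ c i) {δ θ : ℝ} (hθ0 : 0 < θ)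
    (hθ : θ ≤ 3 / 8) (hδθ : δ ≤ Real.sin θ) {u x : ℍ} (hu : ‖u‖ = 1) (hx : x.re = 0)
    (hg : ∀ t ∈ Icc (0 : ℝ) 1, ∀ i, ‖a i - u * exp (t • x)‖ < δ) :
    ‖Yf a c (u * exp x) - Yf a c u‖ ≤ (∑ i, c i) * (θ / Real.sin θ) * ‖x‖ := by
  have hθπ : θ < Real.pi := by linarith [Real.pi_gt_three]
  have hδθ' : δ ≤ θ := hδθ.trans (Real.sin_le hθ0.le)
  -- the geodesic and its unit/guard properties
  have hγ1 : ∀ t : ℝ, ‖u * exp (t • x)‖ = 1 := fun t => by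
    rw [norm_mul, hu, norm_exp_of_re_eq_zero (by simp [hx]), mul_one]
  have hgd : ∀ t ∈ Icc (0 : ℝ) 1, ∀ i, ‖a i * star (u * exp (t • x)) - 1‖ < 1 / 2 := fun t ht i => by
    rw [norm_mul_star_sub_one (hγ1 t)]; linarith [hg t ht i]
  -- derivative of `Y ∘ γ`
  have hder : ∀ t ∈ Icc (0 : ℝ) 1, HasDerivAt (fun s : ℝ => Yf a c (u * exp (s • x)))
      (YD a c (u * exp (t • x)) (u * exp (t • x) * x)) t := by
    intro t ht
    have hγ : HasDerivAt (fun s : ℝ => u * exp (s • x)) (u * exp (t • x) * x) t := by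
      have h := (hasDerivAt_exp_smul_const (𝕂 := ℝ) x t).const_mul u
      simpa [mul_assoc] using h
    exact (hasStrictFDerivAt_Yf c fun i => (hgd t ht i).trans (by norm_num)).hasFDerivAt.comp_hasDerivAt t hγ
  -- the bound on the derivative
  have hbound : ∀ t ∈ Icc (0 : ℝ) 1, ‖YD a c (u * exp (t • x)) (u * exp (t • x) * x)‖ ≤ (∑ i, c i) * (θ / Real.sin θ) * ‖x‖ := by
    intro t ht
    obtain ⟨w, hw_def⟩ : ∃ w : ℍ, w = u * exp (t • x) := ⟨_, rfl⟩
    have hw : ‖w‖ = 1 := by rw [hw_def]; exact hγ1 t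
    have hgw : ∀ i, ‖a i * star w - 1‖ < 1 / 2 := by rw [hw_def]; exact hgd t ht
    have hgw' : ∀ i, ‖a i - w‖ < δ := by rw [hw_def]; exact hg t ht
    rw [← hw_def, YD_apply_mul c hw ha hgw hx, norm_neg, Finset.sum_mul, Finset.sum_mul]
    refine (norm_sum_le _ _).trans (Finset.sum_le_sum fun i _ => ?_)
    have hW1 : ‖a i * star w‖ = 1 := by simp [norm_mul, ha i, hw]
    have hWδ : ‖a i * star w - 1‖ < δ := by rw [norm_mul_star_sub_one hw]; exact hgw' i
    have hZre : (qlog (a i * star w)).re = 0 := qlog_re_of_norm_eq_one hW1 (by linarith)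
    have hZθ : ‖qlog (a i * star w)‖ < θ := norm_qlog_lt_of_chord hW1 hWδ hδθ hθ0 hθ
    have hXre : (w * x * star w).re = 0 := re_mul_mul_star w hx
    have hXn : ‖w * x * star w‖ = ‖x‖ := by rw [norm_mul, norm_mul, Quaternion.norm_star, hw, one_mul, mul_one]
    rw [norm_smul, Real.norm_of_nonneg (hc i)]
    calc c i * ‖N (qlog (a i * star w)) (w * x * star w)‖ ≤ c i * (θ / Real.sin θ * ‖w * x * star w‖) :=
          mul_le_mul_of_nonneg_left (norm_N_le hZre hXre hZθ.le hθ0 hθπ) (hc i)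
      _ = c i * (θ / Real.sin θ) * ‖x‖ := by rw [hXn]; ring
  have h := norm_image_sub_le_of_norm_deriv_le_segment_01' (f := fun s : ℝ => Yf a c (u * exp (s • x)))
    (fun t ht => (hder t ht).hasDerivWithinAt) (fun t ht => hbound t (Ico_subset_Icc_self ht))
  simpa using h

/-- The exponent is imaginary with norm `< 1` on the guard `‖aᵢū − 1‖ < 1∕2` when `cᵢ ≥ 0`, `Σcᵢ ≤ 1` (pub-balaban's `sum_smul_mem_imBall`). [folklore] -/
theorem Yf_re_eq_zero {a : ι → ℍ} (c : ι → ℝ) {u : ℍ} (hu : ‖u‖ = 1) (ha : ∀ i, ‖a i‖ = 1) (hc : ∀ i, 0 ≤ c i)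
    (hs : ∑ i, c i ≤ 1) (hg : ∀ i, ‖a i * star u - 1‖ < 1 / 2) : (Yf a c u).re = 0 := by
  have hW1 : ∀ i, ‖a i * star u‖ = 1 := fun i => by simp [norm_mul, ha i, hu]
  have hZmem : ∀ i, qlog (a i * star u) ∈ imBall := fun i =>
    ⟨qlog_re_of_norm_eq_one (hW1 i) ((hg i).trans (by norm_num)), (norm_qlog_lt_one (hg i)).trans (by linarith [Real.pi_gt_three])⟩
  exact (sum_smul_mem_imBall (Z := fun i => qlog (a i * star u)) hZmem hc hs).1

/-- ★★★ **GLOBAL INJECTIVITY OF THE exp-mean-log FIBRE MAP ON ITS GUARD SET.**  Unit quaternions `aᵢ` (`i ∈ ι` finite), weights `cᵢ ≥ 0`, an angle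
`0 < θ ≤ 3∕8` and a chord `δ ≤ sin θ` with the smallness **`(Σᵢcᵢ)·θ² < sin²θ`**.  Then `k(u) = exp(Σᵢcᵢ•qlog(aᵢū))·u` is INJECTIVE on
`{u : ‖u‖ = 1, ∀ i ‖aᵢū − 1‖ < δ}`.  Proof: `k u = k u′ = z` gives `e^{Y(u)} = z ū`, `e^{Y(u′)} = z ū′`, so `‖u − u′‖ = ‖e^{Y u} − e^{Y u′}‖ ≤ ‖Y u − Y u′‖`
(`norm_exp_sub_exp_le`) `≤ (Σcᵢ)(θ∕sin θ)·d` along the geodesic from `u` to `u′ = u eˣ`, `d = ‖x‖` (`norm_Yf_sub_Yf_le`; the geodesic stays guarded by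
`norm_sub_mul_exp_smul_lt`), while `‖u − u′‖ = 2 sin(d∕2) ≥ (sin θ∕θ)·d` (`d∕2 < θ`); with `(Σcᵢ)θ² < sin²θ` this forces `d = 0`.
HONEST LIMIT: an explicit-smallness case of the conjectured sharp `(1 − Σcᵢ)`-expansion (numerics `N08-EML-JACOBIAN.md` §2); nothing of Bałaban asserted.
[cite: Balaban1987RG1, (0.4) p.253 (the averaging whose one-variable law this is; bookkeeping)] -/
theorem injOn_kf {a : ι → ℍ} {c : ι → ℝ} (ha : ∀ i, ‖a i‖ = 1) (hc : ∀ i, 0 ≤ c i) {δ θ : ℝ} (hθ0 : 0 < θ) (hθ : θ ≤ 3 / 8)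
    (hδθ : δ ≤ Real.sin θ) (hs : (∑ i, c i) * θ ^ 2 < Real.sin θ ^ 2) :
    InjOn (kf a c) {u : ℍ | ‖u‖ = 1 ∧ ∀ i, ‖a i * star u - 1‖ < δ} := by
  intro u hu u' hu' heq
  rcases hu with ⟨hu1, hug⟩
  rcases hu' with ⟨hu1', hug'⟩
  have hθπ : θ < Real.pi := by linarith [Real.pi_gt_three]
  have hsinθ : 0 < Real.sin θ := Real.sin_pos_of_pos_of_lt_pi hθ0 hθπ
  have hδθ' : δ ≤ θ := hδθ.trans (Real.sin_le hθ0.le)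
  have hs1 : ∑ i, c i ≤ 1 := by
    by_contra h
    have h' : 1 < ∑ i, c i := not_le.1 h
    have : Real.sin θ ^ 2 ≤ θ ^ 2 := pow_le_pow_left₀ hsinθ.le (Real.sin_le hθ0.le) 2
    nlinarith
  -- empty index set: the map is the identity
  rcases isEmpty_or_nonempty ι with hι | ⟨⟨i₀⟩⟩
  · have hY : ∀ w, Yf a c w = 0 := fun w => by simp [Yf]
    simpa [kf, hY] using heq
  -- unit algebra
  have hus : u * star u = 1 := by rw [Quaternion.self_mul_star, Quaternion.normSq_eq_norm_mul_self, hu1]; simp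
  have hus' : u' * star u' = 1 := by rw [Quaternion.self_mul_star, Quaternion.normSq_eq_norm_mul_self, hu1']; simp
  have hsu : star u * u = 1 := by rw [Quaternion.star_mul_self, Quaternion.normSq_eq_norm_mul_self, hu1]; simp
  have hg : ∀ i, ‖a i - u‖ < δ := fun i => by rw [← norm_mul_star_sub_one hu1]; exact hug i
  have hg' : ∀ i, ‖a i - u'‖ < δ := fun i => by rw [← norm_mul_star_sub_one hu1']; exact hug' i
  have hδ0 : 0 < δ := (norm_nonneg _).trans_lt (hg i₀)
  -- the relative position `v = ū u′` and its logarithm `x`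
  set v := star u * u' with hv_def
  have hv1 : ‖v‖ = 1 := by rw [hv_def, norm_mul, Quaternion.norm_star, hu1, hu1', one_mul]
  have hvsub : ‖v - 1‖ = ‖u' - u‖ := by
    rw [hv_def, show star u * u' - 1 = star u * (u' - u) by rw [mul_sub, hsu], norm_mul, Quaternion.norm_star, hu1, one_mul]
  have huu' : ‖u' - u‖ < 2 * δ := by
    calc ‖u' - u‖ = ‖(a i₀ - u) - (a i₀ - u')‖ := by congr 1; abel
      _ ≤ ‖a i₀ - u‖ + ‖a i₀ - u'‖ := norm_sub_le _ _
      _ < δ + δ := add_lt_add (hg i₀) (hg' i₀)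
      _ = 2 * δ := by ring
  have hv34 : ‖v - 1‖ ≤ 3 / 4 := by rw [hvsub]; linarith
  have hv1' : ‖v - 1‖ < 1 := by linarith
  set x := qlog v with hx_def
  have hx : x.re = 0 := qlog_re_of_norm_eq_one hv1 hv1'
  have hexpx : exp x = v := exp_qlog hv1'
  obtain ⟨hd3, hchord⟩ := norm_sub_one_eq_two_mul_sin hv1 hv34
  have hd3 : ‖x‖ ≤ 3 := hd3
  have hchord : ‖v - 1‖ = 2 * Real.sin (‖x‖ / 2) := hchord
  have hxπ : ‖x‖ < Real.pi := by linarith [Real.pi_gt_three]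
  -- `d/2 < θ`
  have hdθ : ‖x‖ / 2 < θ := by
    by_contra hle
    have hle : θ ≤ ‖x‖ / 2 := not_lt.1 hle
    have h1 : Real.sin θ ≤ Real.sin (‖x‖ / 2) :=
      Real.sin_le_sin_of_le_of_le_pi_div_two (by linarith) (by linarith [Real.pi_gt_three]) hle
    linarith
  -- the geodesic from `u` to `u′`
  have hend : u * exp x = u' := by rw [hexpx, hv_def, ← mul_assoc, hus, one_mul]
  have hpath : ∀ t ∈ Icc (0 : ℝ) 1, ∀ i, ‖a i - u * exp (t • x)‖ < δ := fun t ht i =>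
    norm_sub_mul_exp_smul_lt (ha i) hu1 hx hxπ (by linarith) (hg i) (by rw [hend]; exact hg' i) ht.1 ht.2
  -- (B) the exponent moves little
  have hB : ‖Yf a c u' - Yf a c u‖ ≤ (∑ i, c i) * (θ / Real.sin θ) * ‖x‖ := by
    rw [← hend]; exact norm_Yf_sub_Yf_le c ha hc hθ0 hθ hδθ hu1 hx hpath
  -- (A) `e^{Y u} = z ū`, `e^{Y u′} = z ū′`
  have hgu : ∀ i, ‖a i * star u - 1‖ < 1 / 2 := fun i => (hug i).trans_le (by linarith)
  have hgu' : ∀ i, ‖a i * star u' - 1‖ < 1 / 2 := fun i => (hug' i).trans_le (by linarith)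
  have hYre : (Yf a c u).re = 0 := Yf_re_eq_zero c hu1 ha hc hs1 hgu
  have hYre' : (Yf a c u').re = 0 := Yf_re_eq_zero c hu1' ha hc hs1 hgu'
  have hz1 : ‖kf a c u‖ = 1 := by rw [kf, norm_mul, norm_exp_of_re_eq_zero hYre, hu1, mul_one]
  have hE : exp (Yf a c u) = kf a c u * star u := by rw [kf, mul_assoc, hus, mul_one]
  have hE' : exp (Yf a c u') = kf a c u * star u' := by rw [heq, kf, mul_assoc, hus', mul_one]
  have hA : ‖u - u'‖ ≤ ‖Yf a c u - Yf a c u'‖ := by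
    calc ‖u - u'‖ = ‖star (u - u')‖ := (Quaternion.norm_star _).symm
      _ = ‖kf a c u * (star u - star u')‖ := by rw [norm_mul, hz1, one_mul, star_sub]
      _ = ‖exp (Yf a c u) - exp (Yf a c u')‖ := by rw [mul_sub, hE, hE']
      _ ≤ ‖Yf a c u - Yf a c u'‖ := norm_exp_sub_exp_le hYre hYre'
  -- the chord from below and the contradiction
  have hupper : ‖u - u'‖ ≤ (∑ i, c i) * (θ / Real.sin θ) * ‖x‖ := hA.trans (by rwa [norm_sub_rev] at hB)
  have hlower : Real.sin θ / θ * ‖x‖ ≤ ‖u - u'‖ := by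
    rw [norm_sub_rev, ← hvsub, hchord]
    rcases eq_or_ne x 0 with hx0 | hx0
    · simp [hx0]
    have hd0 : 0 < ‖x‖ / 2 := by positivity
    have hmono := N08HaarCompatibilityGuardJacobian.sin_div_le_sin_div hd0 hdθ.le hθπ.le
    rw [div_le_div_iff₀ hθ0 hd0] at hmono
    rw [div_mul_eq_mul_div, div_le_iff₀ hθ0]
    linarith
  by_contra hne
  have hx0 : x ≠ 0 := by
    intro hx0
    apply hne
    rw [← hend, hx0, NormedSpace.exp_zero, mul_one]
  have hd : 0 < ‖x‖ := norm_pos_iff.2 hx0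
  have h1 : Real.sin θ / θ * ‖x‖ ≤ (∑ i, c i) * (θ / Real.sin θ) * ‖x‖ := hlower.trans hupper
  have h2 : Real.sin θ / θ ≤ (∑ i, c i) * (θ / Real.sin θ) := le_of_mul_le_mul_right h1 hd
  have hθne : θ ≠ 0 := hθ0.ne'
  have hsne : Real.sin θ ≠ 0 := hsinθ.ne'
  have h3 : Real.sin θ ^ 2 ≤ (∑ i, c i) * θ ^ 2 := by
    have h4 := mul_le_mul_of_nonneg_right h2 (by positivity : (0 : ℝ) ≤ θ * Real.sin θ)
    have e1 : Real.sin θ / θ * (θ * Real.sin θ) = Real.sin θ ^ 2 := by field_simp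
    have e2 : (∑ i, c i) * (θ / Real.sin θ) * (θ * Real.sin θ) = (∑ i, c i) * θ ^ 2 := by field_simp
    rwa [e1, e2] at h4
  linarith

/-- THE [B10] SLOT NUMBERS (`N = 2`, typed guard `δ₂ = 1∕3`, weights `cᵢ = 1∕#Idx` over non-central indices so `Σcᵢ = 1 − L^{1−d} ≤ 8∕9` at `L = 3`,
`d = 3`): with `θ = 7∕20` one has `1∕3 ≤ sin(7∕20)` and `(8∕9)(7∕20)² < sin²(7∕20)` (`Real.sin_gt_sub_cube`), so the fibre map is injective on the
whole guard set `‖aᵢū − 1‖ < 1∕3` whenever `Σcᵢ ≤ 8∕9`. [cite: Balaban1985UV3, p.260 (the SU(2) slot; bookkeeping)] -/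
theorem injOn_kf_slot {a : ι → ℍ} {c : ι → ℝ} (ha : ∀ i, ‖a i‖ = 1) (hc : ∀ i, 0 ≤ c i) (hs : ∑ i, c i ≤ 8 / 9) :
    InjOn (kf a c) {u : ℍ | ‖u‖ = 1 ∧ ∀ i, ‖a i * star u - 1‖ < 1 / 3} := by
  have hsin : (7 / 20 : ℝ) - (7 / 20) ^ 3 / 6 < Real.sin (7 / 20) := Real.sin_gt_sub_cube (by norm_num)
  have h1 : (1 / 3 : ℝ) ≤ Real.sin (7 / 20) := by nlinarith
  have h2 : (∑ i, c i) * (7 / 20 : ℝ) ^ 2 < Real.sin (7 / 20) ^ 2 := by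
    have h3 : (0 : ℝ) < 7 / 20 - (7 / 20) ^ 3 / 6 := by norm_num
    have h4 : ((7 / 20 : ℝ) - (7 / 20) ^ 3 / 6) ^ 2 < Real.sin (7 / 20) ^ 2 := pow_lt_pow_left₀ hsin h3.le two_ne_zero
    nlinarith
  exact injOn_kf ha hc (by norm_num) (by norm_num) h1 h2

end Fibre

/-! ## §2 The corollary on `SU(2)` in the letters of pub-balaban's fibre normal form -/

section SU2

open scoped Matrix.Norms.L2Operator

open Literature.MathematicalPhysics.QuantumLattice (quatMatrix quatMatrix_mul quatMatrix_smul su2Quat norm_su2Quat quatToSU2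
  quatToSU2_su2Quat quatMatrix_su2Quat)
open Literature.MathematicalPhysics.QuantumFieldTheory.Balaban1983to89.T4HaarSU2Translate (quatMatrix_sum su2Quat_eq_of_coe_eq)

variable {ι : Type*} [Fintype ι]

/-- Dictionary: `↑(h) * star ↑W = quatMatrix (su2Quat h * star (su2Quat W))`. [folklore] -/
theorem coe_mul_star_coe_eq_quatMatrix (h W : Matrix.specialUnitaryGroup (Fin 2) ℂ) :
    (h : Matrix (Fin 2) (Fin 2) ℂ) * star (W : Matrix (Fin 2) (Fin 2) ℂ) = quatMatrix (su2Quat h * star (su2Quat W)) := by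
  have := coe_mul_star_coe_quatToSU2 h (norm_su2Quat W)
  rwa [quatToSU2_su2Quat] at this

/-- The fibre normal form read in the quaternion model: if `↑(K W) = exp(Σᵢ(cᵢ:ℂ)•mlog(hᵢW*))·W` with `‖hᵢW* − 1‖ < 1` then
`kf (su2Quat ∘ h) c (su2Quat W) = su2Quat (K W)`. [folklore] -/
theorem kf_su2Quat_eq (h : ι → Matrix.specialUnitaryGroup (Fin 2) ℂ) (c : ι → ℝ) {W KW : Matrix.specialUnitaryGroup (Fin 2) ℂ}
    (hg : ∀ i, ‖(h i : Matrix (Fin 2) (Fin 2) ℂ) * star (W : Matrix (Fin 2) (Fin 2) ℂ) - 1‖ < 1)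
    (hKW : (KW : Matrix (Fin 2) (Fin 2) ℂ) =
      NormedSpace.exp (∑ i, (c i : ℂ) • MatrixLog.mlog ((h i : Matrix (Fin 2) (Fin 2) ℂ) * star (W : Matrix (Fin 2) (Fin 2) ℂ)))
        * (W : Matrix (Fin 2) (Fin 2) ℂ)) :
    kf (fun i => su2Quat (h i)) c (su2Quat W) = su2Quat KW := by
  have hgq : ∀ i, ‖su2Quat (h i) * star (su2Quat W) - 1‖ < 1 := fun i => by
    rw [← norm_quatMatrix_sub_one, ← coe_mul_star_coe_eq_quatMatrix]; exact hg i
  symm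
  apply su2Quat_eq_of_coe_eq
  rw [hKW, kf, quatMatrix_mul, quatMatrix_exp, quatMatrix_su2Quat]
  congr 2
  rw [Yf, quatMatrix_sum]
  refine Finset.sum_congr rfl fun i _ => ?_
  rw [quatMatrix_smul, quatMatrix_qlog (hgq i), coe_mul_star_coe_eq_quatMatrix]

/-- ★★ **INJECTIVITY OF THE GUARDED exp-mean-log FIBRE LAW ON `SU(2)`** (the letters of `T4EMLFibreAC.haar_restrict_map_absolutelyContinuous_expMeanLog`):
`hᵢ ∈ SU(2)`, weights `cᵢ ≥ 0`, an angle `0 < θ ≤ 3∕8` and a chord `δ ≤ sin θ` with `(Σcᵢ)θ² < sin²θ`; on a set `S ⊆ SU(2)` where the guard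
`‖hᵢW* − 1‖ < δ` holds (`L²`-operator norm) and `↑(K W) = exp(Σᵢ(cᵢ:ℂ)•mlog(hᵢW*))·W`, the map `K` is INJECTIVE. [cite: Balaban1987RG1, (0.4) p.253
(the averaging; bookkeeping — nothing of print asserted)] -/
theorem injOn_expMeanLog {S : Set (Matrix.specialUnitaryGroup (Fin 2) ℂ)} (h : ι → Matrix.specialUnitaryGroup (Fin 2) ℂ) {c : ι → ℝ}
    (hc : ∀ i, 0 ≤ c i) {δ θ : ℝ} (hθ0 : 0 < θ) (hθ : θ ≤ 3 / 8) (hδθ : δ ≤ Real.sin θ) (hs : (∑ i, c i) * θ ^ 2 < Real.sin θ ^ 2)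
    {K : Matrix.specialUnitaryGroup (Fin 2) ℂ → Matrix.specialUnitaryGroup (Fin 2) ℂ}
    (hg : ∀ W ∈ S, ∀ i, ‖(h i : Matrix (Fin 2) (Fin 2) ℂ) * star (W : Matrix (Fin 2) (Fin 2) ℂ) - 1‖ < δ)
    (hKW : ∀ W ∈ S, (K W : Matrix (Fin 2) (Fin 2) ℂ) =
      NormedSpace.exp (∑ i, (c i : ℂ) • MatrixLog.mlog ((h i : Matrix (Fin 2) (Fin 2) ℂ) * star (W : Matrix (Fin 2) (Fin 2) ℂ)))
        * (W : Matrix (Fin 2) (Fin 2) ℂ)) :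
    InjOn K S := by
  set a : ι → ℍ := fun i => su2Quat (h i) with ha_def
  have ha : ∀ i, ‖a i‖ = 1 := fun i => norm_su2Quat (h i)
  have hδ1 : δ < 1 := by
    have := hδθ.trans (Real.sin_le hθ0.le); linarith
  have hgq : ∀ W ∈ S, ∀ i, ‖a i * star (su2Quat W) - 1‖ < δ := fun W hW i => by
    rw [ha_def, ← norm_quatMatrix_sub_one, ← coe_mul_star_coe_eq_quatMatrix]; exact hg W hW i
  have hk : ∀ W ∈ S, kf a c (su2Quat W) = su2Quat (K W) := fun W hW =>
    kf_su2Quat_eq h c (fun i => (hg W hW i).trans hδ1) (hKW W hW)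
  intro W hW W' hW' hKK
  have hq : su2Quat W = su2Quat W' :=
    injOn_kf ha hc hθ0 hθ hδθ hs ⟨norm_su2Quat W, hgq W hW⟩ ⟨norm_su2Quat W', hgq W' hW'⟩ (by rw [hk W hW, hk W' hW', hKK])
  rw [← quatToSU2_su2Quat W, hq, quatToSU2_su2Quat]

/-- ★★ **THE SAME AT THE TYPED GUARD OF THE [B10] SLOT**: guard `‖hᵢW* − 1‖ < δ₂ = deltaSU (Fin 2)` (`= min(1∕3, π∕2) ≤ 1∕3`) and total weight
`Σcᵢ ≤ 8∕9` (the printed weights `cᵢ = 1∕#Idx` over the non-central indices of a coarse bond have `Σcᵢ = 1 − L^{1−d} = 8∕9` at `L = 3`, `d = 3`):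
the guarded fibre law is injective on `S` — NO sheet count is needed for the density engine of part 25 on this range. [cite: Balaban1985UV3, p.260 (SU(2) slot;
bookkeeping)] -/
theorem injOn_expMeanLog_deltaSU {S : Set (Matrix.specialUnitaryGroup (Fin 2) ℂ)} (h : ι → Matrix.specialUnitaryGroup (Fin 2) ℂ) {c : ι → ℝ}
    (hc : ∀ i, 0 ≤ c i) (hs : ∑ i, c i ≤ 8 / 9)
    {K : Matrix.specialUnitaryGroup (Fin 2) ℂ → Matrix.specialUnitaryGroup (Fin 2) ℂ}
    (hg : ∀ W ∈ S, ∀ i, ‖(h i : Matrix (Fin 2) (Fin 2) ℂ) * star (W : Matrix (Fin 2) (Fin 2) ℂ) - 1‖ < ExpMeanLog.deltaSU (Fin 2))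
    (hKW : ∀ W ∈ S, (K W : Matrix (Fin 2) (Fin 2) ℂ) =
      NormedSpace.exp (∑ i, (c i : ℂ) • MatrixLog.mlog ((h i : Matrix (Fin 2) (Fin 2) ℂ) * star (W : Matrix (Fin 2) (Fin 2) ℂ)))
        * (W : Matrix (Fin 2) (Fin 2) ℂ)) :
    InjOn K S := by
  have hsin : (7 / 20 : ℝ) - (7 / 20) ^ 3 / 6 < Real.sin (7 / 20) := Real.sin_gt_sub_cube (by norm_num)
  have h1 : (1 / 3 : ℝ) ≤ Real.sin (7 / 20) := by nlinarith
  have h2 : (∑ i, c i) * (7 / 20 : ℝ) ^ 2 < Real.sin (7 / 20) ^ 2 := by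
    have h3 : (0 : ℝ) < 7 / 20 - (7 / 20) ^ 3 / 6 := by norm_num
    have h4 : ((7 / 20 : ℝ) - (7 / 20) ^ 3 / 6) ^ 2 < Real.sin (7 / 20) ^ 2 := pow_lt_pow_left₀ hsin h3.le two_ne_zero
    nlinarith
  exact injOn_expMeanLog h hc (by norm_num) (by norm_num) h1 h2
    (fun W hW i => ExpMeanLog.lt_third_of_lt_deltaSU (hg W hW i)) hKW

end SU2

end Summit.QuantumFields.YangMills.BalabanUVNodes.N08HaarCompatibilityGuardCoreInjective

end
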